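import Literature.Geometry.Riemannian.FamilyLaplacianRegularity
import Literature.Geometry.Riemannian.TimeDerivativeContinuity
import Literature.Geometry.Riemannian.LinearHeatUniqueness
import Literature.Analysis.Calculus.FlatGluing
import Mathlib.Analysis.Calculus.FDeriv.Symmetric
import Literature.Analysis.Calculus.BorelCutoffSeries
import Mathlib.Geometry.Manifold.PartitionOfUnity
import HarnessLib

/-!
# Formal power series solutions of the linear heat equation on a closed manifold (Borel's lemma)

For the linear heat-type equation `∂ₛ w = L(s) w`, `L(s) f = Δ_{h(s)} f − Q(s) f`, on a closed
manifold `M` with a family of metrics `h` and a potential `Q` smooth on `M × ℝ`, and smooth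
initial data `w₀`, we construct a smooth `W : M × ℝ → ℝ` with `W(0) = w₀` which solves the
equation **to infinite order at `s = 0`**: every time slice of the residual
`∂ₛ W − L(s) W` is flat at `s = 0`. Glued with zero for `s < 0`, the negative residual is then a
smooth forcing `G` supported in `s ≥ 0` (`exists_flat_corrector`); a solution `v` of
`∂ₛ v = L(s) v + G` vanishing for `s ≤ 0` gives the solution `W + v` of the Cauchy problem. This is
the classical reduction of an initial value problem to a problem with data vanishing in the past
(e.g. Hörmander, ALPDO III, proof of Thm. 23.1.2; Trèves 1975, §41), via É. Borel's theorem.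

* `FlatTo k u` — a smooth `u : ℝ → ℝ` with `u^{(i)}(0) = 0`, `i ≤ k`; closed under smooth
  multiples, sums and differences (Leibniz, Mathlib's `iteratedDeriv_mul`).
* `contMDiff_iteratedDeriv_time`, `contMDiff_heatOp` — time derivatives and the heat operator
  preserve smooth space-time functions (`contMDiffOn_derivWithin_time_of_uniqueDiffOn`,
  `IsContMDiffFamilyOn.contMDiffOn_laplaceBeltrami`).
* `flatTo_heatOp` — **the heat operator preserves flatness in time**: the coordinate expression
  of `Δ_{h(s)}` (`dalembertian_eq_sum_localFrame`) has coefficients smooth in `s`, and time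
  derivatives commute with the spatial derivatives of the chart representative
  (`iteratedDeriv_fderiv_slice_eq_zero`, finite-order slice form).
* `heatTaylor`, `heatJet` — the Taylor polynomials `P_k` and jets `a_k = P_k^{(k)}(0)` of the
  formal solution: `P₀ = w₀`, `P_{k+1} = P_k + s^{k+1}/(k+1)! · (d/ds)^k [L P_k]|₀`
  (`heatJet_succ`, `iteratedDeriv_heatTaylor_of_le`); `iteratedDeriv_residual_eq_zero`: a smooth
  `W` with these jets has flat residual.
* `exists_contMDiff_forall_iteratedDeriv_eq_manifold` — **Borel's lemma in time on a compact
  manifold** (finite smooth partition of unity subordinate to charts + the cut-off series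
  `exists_borel_extension` of `BorelCutoffSeries.lean` on the model space).
* `contMDiff_timeCutoff_manifold` — gluing a flat space-time function with zero across `s = 0`
  (`IsTFlatOn.contDiffOn_cutoff` of `FlatGluing.lean` in product charts).
* Section `Slice`: slice forms, valid for targets in any universe and at FINITE order, of the
  commutation of time and space derivatives (`deriv_fderiv_slice_comm`,
  `iteratedDeriv_fderiv_slice_eq_zero`; operator forms: `FlatGluing.tDeriv_fderiv`).
* `exists_flat_corrector` — the statement above.

Everything is proved; the definitions are `FlatTo`, `heatOp`, `heatTaylor`, `heatJet`.

## References

* L. Hörmander, *The analysis of linear partial differential operators I*, 2nd ed., Springer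
  1990, Thm. 1.2.6 (Borel). [folklore]
* F. Trèves, *Basic linear partial differential equations*, Academic Press 1975, §41
  (reduction of the mixed problem to zero data). [cite: Treves1975, §41]
* P. Topping, *Lectures on the Ricci flow*, CUP 2006, §1.2.3 (smooth families).
  [cite: Topping2006, §1.2.3]
-/

noncomputable section

open Set Function Filter Manifold Bundle
open scoped Manifold ContDiff Topology

namespace Literature.Geometry.Riemannian

open Lorentzian Lorentzian.PseudoRiemannianMetric Literature.Analysis.Calculus

/-! ### Slice calculus on `E × ℝ`: time and space derivatives commute (finite order) -/

section Slice

variable {E V : Type*} [NormedAddCommGroup E] [NormedSpace ℝ E] [NormedAddCommGroup V]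
  [NormedSpace ℝ V]

/-- The time derivative of a slice is the Fréchet derivative on `(0, 1)` (the pointwise form of
`FlatGluing.tDeriv_apply_eq_deriv`). [folklore] -/
theorem deriv_slice_right_eq {F : E × ℝ → V} {y : E} {s : ℝ} (h : DifferentiableAt ℝ F (y, s)) :
    deriv (fun r ↦ F (y, r)) s = fderiv ℝ F (y, s) (0, 1) := by
  have hc : HasDerivAt (fun r : ℝ ↦ ((y, r) : E × ℝ)) ((0 : E), (1 : ℝ)) s := by
    have h1 := (hasFDerivAt_prodMk_right (𝕜 := ℝ) y s).hasDerivAt (x := s)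
    simpa using h1
  exact (h.hasFDerivAt.comp_hasDerivAt s hc).deriv

/-- The spatial derivative of a slice is the Fréchet derivative on `(v, 0)`. [folklore] -/
theorem fderiv_slice_left_eq {F : E × ℝ → V} {y : E} {s : ℝ} (h : DifferentiableAt ℝ F (y, s))
    (v : E) : fderiv ℝ (fun z ↦ F (z, s)) y v = fderiv ℝ F (y, s) (v, 0) := by
  have : HasFDerivAt (fun z ↦ F (z, s))
      ((fderiv ℝ F (y, s)).comp (ContinuousLinearMap.inl ℝ E ℝ)) y :=
    h.hasFDerivAt.comp y (hasFDerivAt_prodMk_left (𝕜 := ℝ) y s)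
  rw [this.fderiv]
  rfl

/-- **`∂ₛ ∂_v F = ∂_v ∂ₛ F` for the slices** at a point where `F` is `C²` (symmetry of the second
derivative). This is the slice form of `FlatGluing.tDeriv_fderiv` (which is stated for the
operator `tDeriv` with `E` and the target in a common universe); here the target `V` and `E`
are arbitrary, as needed for real-valued functions on the model space of a manifold.
[folklore] -/
theorem deriv_fderiv_slice_comm {F : E × ℝ → V} {y : E} {s : ℝ} (hF : ContDiffAt ℝ 2 F (y, s))
    (v : E) :
    deriv (fun r ↦ fderiv ℝ (fun z ↦ F (z, r)) y v) s =
      fderiv ℝ (fun z ↦ deriv (fun r ↦ F (z, r)) s) y v := by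
  have hev : ∀ᶠ p in 𝓝 (y, s), ContDiffAt ℝ 2 F p := hF.eventually (by simp)
  have hdiff : ∀ᶠ p in 𝓝 (y, s), DifferentiableAt ℝ F p :=
    hev.mono fun p hp ↦ hp.differentiableAt (by simp)
  have hD : ContDiffAt ℝ 1 (fderiv ℝ F) (y, s) := hF.fderiv_right (by norm_num)
  have hDd : HasFDerivAt (fderiv ℝ F) (fderiv ℝ (fderiv ℝ F) (y, s)) (y, s) :=
    (hD.differentiableAt (by simp)).hasFDerivAt
  set c := fderiv ℝ (fderiv ℝ F) (y, s) with hc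
  have hsymm : c (0, 1) (v, 0) = c (v, 0) (0, 1) :=
    hF.isSymmSndFDerivAt (by simp) _ _
  have hG : ∀ w : E × ℝ, HasFDerivAt (fun p ↦ fderiv ℝ F p w) (c.flip w) (y, s) := by
    intro w
    have := hDd.clm_apply (hasFDerivAt_const w (y, s))
    simpa using this
  have h1 : (fun r ↦ fderiv ℝ (fun z ↦ F (z, r)) y v) =ᶠ[𝓝 s] fun r ↦ fderiv ℝ F (y, r) (v, 0) := by
    have ht : Tendsto (fun r : ℝ ↦ ((y, r) : E × ℝ)) (𝓝 s) (𝓝 (y, s)) :=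
      (continuous_const.prodMk continuous_id).continuousAt
    filter_upwards [ht.eventually hdiff] with r hr using fderiv_slice_left_eq hr v
  rw [h1.deriv_eq, deriv_slice_right_eq (F := fun p ↦ fderiv ℝ F p (v, 0))
    (hG (v, 0)).differentiableAt, (hG (v, 0)).fderiv]
  have h2 : (fun z ↦ deriv (fun r ↦ F (z, r)) s) =ᶠ[𝓝 y] fun z ↦ fderiv ℝ F (z, s) (0, 1) := by
    have ht : Tendsto (fun z : E ↦ ((z, s) : E × ℝ)) (𝓝 y) (𝓝 (y, s)) :=
      (continuous_id.prodMk continuous_const).continuousAt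
    filter_upwards [ht.eventually hdiff] with z hz using deriv_slice_right_eq hz
  rw [h2.fderiv_eq, fderiv_slice_left_eq (F := fun p ↦ fderiv ℝ F p (0, 1))
    (hG (0, 1)).differentiableAt, (hG (0, 1)).fderiv]
  simp only [ContinuousLinearMap.flip_apply]
  exact hsymm

/-- The time derivative `(z, r) ↦ ∂ᵣ F (z, r)` of a function `C^∞` on `U × ℝ`, `U` open, is `C^∞`
on `U × ℝ` (cf. `ContDiffOn.tDeriv`). [folklore] -/
theorem contDiffOn_deriv_slice {U : Set E} (hU : IsOpen U) {F : E × ℝ → V}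
    (hF : ContDiffOn ℝ ∞ F (U ×ˢ univ)) :
    ContDiffOn ℝ ∞ (fun p : E × ℝ ↦ deriv (fun r ↦ F (p.1, r)) p.2) (U ×ˢ univ) := by
  have hO : IsOpen (U ×ˢ (univ : Set ℝ)) := hU.prod isOpen_univ
  have hD : ContDiffOn ℝ ∞ (fun p ↦ fderiv ℝ F p ((0 : E), (1 : ℝ))) (U ×ˢ univ) :=
    (hF.fderiv_of_isOpen hO (by norm_cast)).clm_apply contDiffOn_const
  refine hD.congr ?_
  rintro ⟨z, r⟩ hp
  exact deriv_slice_right_eq ((hF.contDiffAt (hO.mem_nhds hp)).differentiableAt (by simp))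

/-- **`∂ₛ^i ∂_v F = ∂_v ∂ₛ^i F` for the slices** of `F` of class `C^∞` on `U × ℝ`, `U` open,
`y ∈ U` (iterate `deriv_fderiv_slice_comm`; the operator form is
`FlatGluing.iterate_tDeriv_fderiv`). [folklore] -/
theorem iteratedDeriv_fderiv_slice_comm {U : Set E} (hU : IsOpen U) (i : ℕ) :
    ∀ {F : E × ℝ → V}, ContDiffOn ℝ ∞ F (U ×ˢ univ) → ∀ {y : E}, y ∈ U → ∀ (v : E) (s : ℝ),
      iteratedDeriv i (fun r ↦ fderiv ℝ (fun z ↦ F (z, r)) y v) s =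
        fderiv ℝ (fun z ↦ iteratedDeriv i (fun r ↦ F (z, r)) s) y v := by
  induction i with
  | zero => intro F _ y _ v s; simp only [iteratedDeriv_zero]
  | succ i IH =>
    intro F hF y hy v s
    have hO : IsOpen (U ×ˢ (univ : Set ℝ)) := hU.prod isOpen_univ
    set F' : E × ℝ → V := fun p ↦ deriv (fun r ↦ F (p.1, r)) p.2 with hF'
    have hF's : ContDiffOn ℝ ∞ F' (U ×ˢ univ) := contDiffOn_deriv_slice hU hF
    have hderiv : deriv (fun r ↦ fderiv ℝ (fun z ↦ F (z, r)) y v) =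
        fun r ↦ fderiv ℝ (fun z ↦ F' (z, r)) y v := by
      funext r
      have h2 : ContDiffAt ℝ 2 F (y, r) :=
        (hF.contDiffAt (hO.mem_nhds ⟨hy, mem_univ _⟩)).of_le (by norm_cast)
      exact deriv_fderiv_slice_comm h2 v
    have hfg : (fun z ↦ iteratedDeriv (i + 1) (fun r ↦ F (z, r)) s) =
        fun z ↦ iteratedDeriv i (fun r ↦ F' (z, r)) s := by
      funext z; rw [iteratedDeriv_succ']
    rw [iteratedDeriv_succ', hderiv, IH hF's hy v s, hfg]

/-- **Slices flat to order `k` have spatial derivatives with slices flat to order `k`**: if every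
slice `r ↦ F (z, r)`, `z ∈ U`, is flat to order `k` at `s₀`, then so is `r ↦ ∂_v F (y, r)` for
`y ∈ U`. (Finite-order statement; `FlatGluing.IsTFlatOn` is the infinite-order notion.)
[folklore] -/
theorem iteratedDeriv_fderiv_slice_eq_zero {U : Set E} (hU : IsOpen U) {F : E × ℝ → V}
    (hF : ContDiffOn ℝ ∞ F (U ×ˢ univ)) {k : ℕ} {s₀ : ℝ}
    (hflat : ∀ z ∈ U, ∀ i ≤ k, iteratedDeriv i (fun r ↦ F (z, r)) s₀ = 0) {y : E} (hy : y ∈ U)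
    (v : E) : ∀ i ≤ k, iteratedDeriv i (fun r ↦ fderiv ℝ (fun z ↦ F (z, r)) y v) s₀ = 0 := by
  intro i hi
  rw [iteratedDeriv_fderiv_slice_comm hU i hF hy v s₀]
  have h0 : (fun z ↦ iteratedDeriv i (fun r ↦ F (z, r)) s₀) =ᶠ[𝓝 y] fun _ ↦ (0 : V) := by
    filter_upwards [hU.mem_nhds hy] with z hz using hflat z hz i hi
  rw [h0.fderiv_eq]
  simp

end Slice

/-! ### Flat functions of one variable -/

section Flat

/-- `u : ℝ → ℝ` is smooth and flat to order `k` at `0`. [folklore] -/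
def FlatTo (k : ℕ) (u : ℝ → ℝ) : Prop := ContDiff ℝ ∞ u ∧ ∀ i ≤ k, iteratedDeriv i u 0 = 0

/-- A smooth multiple of a flat function is flat. [folklore] -/
theorem FlatTo.mul_left {k : ℕ} {c u : ℝ → ℝ} (hc : ContDiff ℝ ∞ c) (hu : FlatTo k u) :
    FlatTo k (fun s ↦ c s * u s) := by
  refine ⟨hc.mul hu.1, fun i hi ↦ ?_⟩
  have h := iteratedDeriv_mul (n := i) (x := 0) (hc.contDiffAt.of_le (by exact_mod_cast le_top))
    (hu.1.contDiffAt.of_le (by exact_mod_cast le_top))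
  rw [show (fun s ↦ c s * u s) = c * u from rfl, h]
  refine Finset.sum_eq_zero fun l hl ↦ ?_
  rw [hu.2 (i - l) (by omega), mul_zero]

/-- The difference of flat functions is flat. [folklore] -/
theorem FlatTo.sub {k : ℕ} {u w : ℝ → ℝ} (hu : FlatTo k u) (hw : FlatTo k w) :
    FlatTo k (fun s ↦ u s - w s) := by
  refine ⟨hu.1.sub hw.1, fun i hi ↦ ?_⟩
  rw [show (fun s ↦ u s - w s) = u - w from rfl,
    iteratedDeriv_sub (hu.1.contDiffAt.of_le (by exact_mod_cast le_top))
      (hw.1.contDiffAt.of_le (by exact_mod_cast le_top)), hu.2 i hi, hw.2 i hi, sub_zero]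

/-- The sum of flat functions is flat. [folklore] -/
theorem FlatTo.add {k : ℕ} {u w : ℝ → ℝ} (hu : FlatTo k u) (hw : FlatTo k w) :
    FlatTo k (fun s ↦ u s + w s) := by
  refine ⟨hu.1.add hw.1, fun i hi ↦ ?_⟩
  rw [show (fun s ↦ u s + w s) = u + w from rfl,
    iteratedDeriv_add (hu.1.contDiffAt.of_le (by exact_mod_cast le_top))
      (hw.1.contDiffAt.of_le (by exact_mod_cast le_top)), hu.2 i hi, hw.2 i hi, add_zero]

/-- A finite sum of flat functions is flat. [folklore] -/
theorem FlatTo.sum {k : ℕ} {ι : Type*} (t : Finset ι) {f : ι → ℝ → ℝ}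
    (hf : ∀ i ∈ t, FlatTo k (f i)) : FlatTo k (fun s ↦ ∑ i ∈ t, f i s) := by
  classical
  induction t using Finset.induction_on with
  | empty =>
    refine ⟨by simpa using contDiff_const, fun i _ ↦ ?_⟩
    simp only [Finset.sum_empty]
    rw [iteratedDeriv_const]; simp
  | insert a t ha IH =>
    have h1 : FlatTo k (f a) := hf a (Finset.mem_insert_self a t)
    have h2 : FlatTo k (fun s ↦ ∑ i ∈ t, f i s) := IH fun i hi ↦ hf i (Finset.mem_insert_of_mem hi)
    have := h1.add h2
    simpa only [Finset.sum_insert ha] using this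

/-- The zero function is flat. [folklore] -/
theorem FlatTo.zero (k : ℕ) : FlatTo k (fun _ ↦ (0 : ℝ)) :=
  ⟨contDiff_const, fun i _ ↦ by rw [iteratedDeriv_const]; simp⟩

/-- Flatness is a property of the germ-free function: transfer along an equality of functions.
[folklore] -/
theorem FlatTo.congr {k : ℕ} {u w : ℝ → ℝ} (hu : FlatTo k u) (h : u = w) : FlatTo k w := h ▸ hu

end Flat

/-! ### Smooth families of functions on `M × ℝ`: time derivatives and the heat operator -/

section Family

variable {E : Type*} [NormedAddCommGroup E] [NormedSpace ℝ E]
  {H : Type*} [TopologicalSpace H] {I : ModelWithCorners ℝ E H}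
  {M : Type*} [TopologicalSpace M] [ChartedSpace H M] [IsManifold I ∞ M]

omit [IsManifold I ∞ M] in
/-- A time slice `s ↦ V s x` of a smooth space-time function is smooth. [folklore] -/
theorem contDiff_time_slice {n : ℕ∞ω} {V : ℝ → M → ℝ}
    (hV : ContMDiff (I.prod 𝓘(ℝ, ℝ)) 𝓘(ℝ, ℝ) n (fun p : M × ℝ ↦ V p.2 p.1)) (x : M) :
    ContDiff ℝ n fun s ↦ V s x := by
  rw [← contMDiff_iff_contDiff]
  exact hV.comp (contMDiff_const.prodMk contMDiff_id)

omit [IsManifold I ∞ M] in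
/-- A space slice `x ↦ V s x` of a smooth space-time function is smooth. [folklore] -/
theorem contMDiff_space_slice {n : ℕ∞ω} {V : ℝ → M → ℝ}
    (hV : ContMDiff (I.prod 𝓘(ℝ, ℝ)) 𝓘(ℝ, ℝ) n (fun p : M × ℝ ↦ V p.2 p.1)) (s : ℝ) :
    ContMDiff I 𝓘(ℝ, ℝ) n (V s) :=
  hV.comp (contMDiff_id.prodMk contMDiff_const)

variable [I.Boundaryless]

/-- **All time derivatives of a smooth space-time function are smooth on space-time.**
[folklore] -/
theorem contMDiff_iteratedDeriv_time {V : ℝ → M → ℝ}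
    (hV : ContMDiff (I.prod 𝓘(ℝ, ℝ)) 𝓘(ℝ, ℝ) ∞ (fun p : M × ℝ ↦ V p.2 p.1)) (i : ℕ) :
    ContMDiff (I.prod 𝓘(ℝ, ℝ)) 𝓘(ℝ, ℝ) ∞
      (fun p : M × ℝ ↦ iteratedDeriv i (fun s ↦ V s p.1) p.2) := by
  induction i generalizing V with
  | zero => simpa using hV
  | succ i IH =>
    have h1 := contMDiffOn_derivWithin_time_of_uniqueDiffOn (I := I) (M := M) (u := V) (S := univ)
      uniqueDiffOn_univ (by rw [univ_prod_univ]; exact hV.contMDiffOn)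
    rw [univ_prod_univ] at h1
    have h2 : ContMDiff (I.prod 𝓘(ℝ, ℝ)) 𝓘(ℝ, ℝ) ∞
        (fun p : M × ℝ ↦ deriv (fun s ↦ V s p.1) p.2) := by
      simpa only [derivWithin_univ] using contMDiffOn_univ.1 h1
    have h3 := IH (V := fun s x ↦ deriv (fun r ↦ V r x) s) h2
    refine h3.congr fun p ↦ ?_
    rw [iteratedDeriv_succ']

variable [FiniteDimensional ℝ E] [CompleteSpace E]
  {h : ℝ → PseudoRiemannianMetric I ∞ E (TangentSpace I : M → Type _)} {Q : ℝ → M → ℝ}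

/-- **The heat operator `V ↦ Δ_{h(s)} V(s) − Q(s) V(s)` of a smooth family preserves smooth
space-time functions** (`IsContMDiffFamilyOn.contMDiffOn_laplaceBeltrami`).
[cite: Topping2006, §1.2.3] -/
theorem contMDiff_heatOp (hh : IsContMDiffFamilyOn ∞ h univ)
    (hQ : ContMDiff (I.prod 𝓘(ℝ, ℝ)) 𝓘(ℝ, ℝ) ∞ (fun p : M × ℝ ↦ Q p.2 p.1)) {V : ℝ → M → ℝ}
    (hV : ContMDiff (I.prod 𝓘(ℝ, ℝ)) 𝓘(ℝ, ℝ) ∞ (fun p : M × ℝ ↦ V p.2 p.1)) :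
    ContMDiff (I.prod 𝓘(ℝ, ℝ)) 𝓘(ℝ, ℝ) ∞ (fun p : M × ℝ ↦
      (h p.2).laplaceBeltrami (V p.2) p.1 - Q p.2 p.1 * V p.2 p.1) := by
  have h1 := hh.contMDiffOn_laplaceBeltrami uniqueDiffOn_univ (f := V)
    (by rw [univ_prod_univ]; exact hV.contMDiffOn)
  rw [univ_prod_univ] at h1
  exact (contMDiffOn_univ.1 h1).sub (hQ.mul hV)

omit [IsManifold I ∞ M] [I.Boundaryless] [FiniteDimensional ℝ E] [CompleteSpace E] in
/-- A time slice of a function `C^∞` on `U × ℝ` at a point of `U` is smooth. [folklore] -/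
theorem contDiff_slice_of_contDiffOn_prod {G : E × ℝ → ℝ} {U : Set E}
    (hG : ContDiffOn ℝ ∞ G (U ×ˢ (univ : Set ℝ))) {y : E} (hy : y ∈ U) :
    ContDiff ℝ ∞ fun s ↦ G (y, s) :=
  hG.comp_contDiff (contDiff_const.prodMk contDiff_id) fun s ↦ ⟨hy, mem_univ s⟩

/-- **The heat operator of a smooth family preserves flatness in time**: if every time slice of
the smooth space-time function `V` is flat to order `k` at `s = 0`, then so is every time slice of
`Δ_{h(s)} V(s) − Q(s) V(s)`. In the chart at `x₀`, `Δ_{h(s)} V(s) (x₀)` is the coordinate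
expression `∑ᵢⱼ Ĝ⁻¹ᵢⱼ (∂ᵢ∂ⱼ V̂ − ∑ₗ Γˡᵢⱼ ∂ₗ V̂)` of `dalembertian_eq_sum_localFrame` with coefficients
smooth in `s` and spatial derivatives of `V̂(·, s)` whose time slices are flat
(`iteratedDeriv_fderiv_slice_eq_zero`: time and space derivatives commute).
[cite: Topping2006, §1.2.3] [cite: ONeill1983, Ch. 3, Def. 3.50 ff.] -/
theorem flatTo_heatOp (hh : IsContMDiffFamilyOn ∞ h univ)
    (hQ : ContMDiff (I.prod 𝓘(ℝ, ℝ)) 𝓘(ℝ, ℝ) ∞ (fun p : M × ℝ ↦ Q p.2 p.1)) {V : ℝ → M → ℝ}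
    (hV : ContMDiff (I.prod 𝓘(ℝ, ℝ)) 𝓘(ℝ, ℝ) ∞ (fun p : M × ℝ ↦ V p.2 p.1)) {k : ℕ}
    (hflat : ∀ x, ∀ i ≤ k, iteratedDeriv i (fun s ↦ V s x) 0 = 0) (x₀ : M) :
    FlatTo k (fun s ↦ (h s).laplaceBeltrami (V s) x₀ - Q s x₀ * V s x₀) := by
  classical
  obtain ⟨b⟩ : Nonempty (Module.Basis (Fin (Module.finrank ℝ E)) ℝ E) := ⟨Module.finBasis ℝ E⟩
  set Φ := extChartAt I x₀ with hΦ
  set e := trivializationAt E (TangentSpace I) x₀ with he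
  have hVt : IsOpen Φ.target := isOpen_extChartAt_target x₀
  have hy₀ : Φ x₀ ∈ Φ.target := Φ.map_source (mem_extChartAt_source x₀)
  have hp : x₀ ∈ (chartAt H x₀).source := mem_chart_source H x₀
  -- the chart reading of `V` and its flatness
  set F : E × ℝ → ℝ := fun q ↦ V q.2 (Φ.symm q.1) with hF_def
  have hF : ContDiffOn ℝ ∞ F (Φ.target ×ˢ univ) :=
    contDiffOn_time_chart (k := (⊤ : ℕ∞)) (by rw [univ_prod_univ]; exact hV.contMDiffOn) x₀
  have hFflat : ∀ z ∈ Φ.target, ∀ i ≤ k, iteratedDeriv i (fun r ↦ F (z, r)) 0 = 0 :=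
    fun z _ i hi ↦ hflat (Φ.symm z) i hi
  -- first and second spatial derivatives have flat time slices
  have hD1 : ∀ (v : E), ∀ y ∈ Φ.target, FlatTo k (fun s ↦ fderiv ℝ (fun z ↦ F (z, s)) y v) := by
    intro v y hy
    exact ⟨contDiff_slice_of_contDiffOn_prod
      (contDiffOn_fderiv_slice_apply hVt uniqueDiffOn_univ hF v) hy,
      iteratedDeriv_fderiv_slice_eq_zero hVt hF hFflat hy v⟩
  have hD2 : ∀ (v w : E), ∀ y ∈ Φ.target,
      FlatTo k (fun s ↦ fderiv ℝ (fderiv ℝ (fun z ↦ F (z, s))) y v w) := by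
    intro v w y hy
    set F₁ : E × ℝ → ℝ := fun q ↦ fderiv ℝ (fun z ↦ F (z, q.2)) q.1 w with hF₁
    have hF₁s : ContDiffOn ℝ ∞ F₁ (Φ.target ×ˢ univ) :=
      contDiffOn_fderiv_slice_apply hVt uniqueDiffOn_univ hF w
    have hF₁flat : ∀ z ∈ Φ.target, ∀ i ≤ k, iteratedDeriv i (fun r ↦ F₁ (z, r)) 0 = 0 :=
      fun z hz ↦ iteratedDeriv_fderiv_slice_eq_zero hVt hF hFflat hz w
    have heq : (fun s ↦ fderiv ℝ (fderiv ℝ (fun z ↦ F (z, s))) y v w) =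
        fun s ↦ fderiv ℝ (fun z ↦ F₁ (z, s)) y v := by
      funext s; exact fderiv_fderiv_slice_apply hVt hy (mem_univ s) hF v w
    rw [heq]
    exact ⟨contDiff_slice_of_contDiffOn_prod
      (contDiffOn_fderiv_slice_apply hVt uniqueDiffOn_univ hF₁s v) hy,
      iteratedDeriv_fderiv_slice_eq_zero hVt hF₁s hF₁flat hy v⟩
  -- the metric coefficients, `C^∞` on `Φ.target × ℝ`
  have hG : ∀ i j, ContDiffOn ℝ ∞ (fun q : E × ℝ ↦ (h q.2).val (Φ.symm q.1)
      (e.localFrame b i (Φ.symm q.1)) (e.localFrame b j (Φ.symm q.1))) (Φ.target ×ˢ univ) :=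
    fun i j ↦ hh.contDiffOn_gram_chart x₀ b i j
  have hGinv : ∀ i j, ContDiffOn ℝ ∞ (fun q : E × ℝ ↦ (Matrix.of fun i j ↦ (h q.2).val (Φ.symm q.1)
      (e.localFrame b i (Φ.symm q.1)) (e.localFrame b j (Φ.symm q.1)))⁻¹ i j)
      (Φ.target ×ˢ univ) := by
    intro i j q hq
    have h := contMDiffWithinAt_matrix_inv (J := 𝓘(ℝ, E × ℝ)) (k := ∞)
      (A := fun q : E × ℝ ↦ Matrix.of fun i j ↦ (h q.2).val (Φ.symm q.1)
        (e.localFrame b i (Φ.symm q.1)) (e.localFrame b j (Φ.symm q.1)))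
      (s := Φ.target ×ˢ univ) (x₀ := q)
      (fun i j ↦ contMDiffWithinAt_iff_contDiffWithinAt.2 (hG i j q hq))
      (det_gram_comp_extChartAt_symm_ne_zero b (h q.2) hq.1) i j
    exact contMDiffWithinAt_iff_contDiffWithinAt.1 h
  have hdG : ∀ i j (v : E), ContDiffOn ℝ ∞ (fun q : E × ℝ ↦ fderiv ℝ (fun z ↦ (h q.2).val (Φ.symm z)
      (e.localFrame b i (Φ.symm z)) (e.localFrame b j (Φ.symm z))) q.1 v) (Φ.target ×ˢ univ) :=
    fun i j v ↦ contDiffOn_fderiv_slice_apply hVt uniqueDiffOn_univ (hG i j) v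
  -- the coordinate formula at `x₀`, for every time
  have hagree : ∀ s, (h s).laplaceBeltrami (V s) x₀ = ∑ i, ∑ j,
      (Matrix.of fun i j ↦ (h s).val (Φ.symm (Φ x₀))
        (e.localFrame b i (Φ.symm (Φ x₀))) (e.localFrame b j (Φ.symm (Φ x₀))))⁻¹ i j *
      (fderiv ℝ (fderiv ℝ (V s ∘ Φ.symm)) (Φ x₀) (b i) (b j) -
        ∑ l, (∑ k, 2⁻¹ *
          (fderiv ℝ (fun z ↦ (h s).val (Φ.symm z)
              (e.localFrame b j (Φ.symm z)) (e.localFrame b k (Φ.symm z))) (Φ x₀) (b i) +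
            fderiv ℝ (fun z ↦ (h s).val (Φ.symm z)
              (e.localFrame b i (Φ.symm z)) (e.localFrame b k (Φ.symm z))) (Φ x₀) (b j) -
            fderiv ℝ (fun z ↦ (h s).val (Φ.symm z)
              (e.localFrame b i (Φ.symm z)) (e.localFrame b j (Φ.symm z))) (Φ x₀) (b k)) *
          (Matrix.of fun i j ↦ (h s).val (Φ.symm (Φ x₀))
            (e.localFrame b i (Φ.symm (Φ x₀))) (e.localFrame b j (Φ.symm (Φ x₀))))⁻¹ k l) *
          fderiv ℝ (V s ∘ Φ.symm) (Φ x₀) (b l)) := by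
    intro s
    have hf2 : CMDiffAt 2 (V s) x₀ :=
      ((contMDiff_space_slice hV s).of_le (by norm_cast)) x₀
    haveI := (h s).hasLeviCivita
    rw [laplaceBeltrami_eq_dalembertian]
    exact dalembertian_eq_sum_localFrame (h s) b hp hf2
      (Gh := fun z i j ↦ (h s).val (Φ.symm z) (e.localFrame b i (Φ.symm z))
        (e.localFrame b j (Φ.symm z)))
      (Eventually.of_forall fun _ _ _ ↦ rfl) EventuallyEq.rfl
  -- flatness of the coordinate expression
  have hsl : ∀ {G : E × ℝ → ℝ}, ContDiffOn ℝ ∞ G (Φ.target ×ˢ univ) →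
      ContDiff ℝ ∞ fun s ↦ G (Φ x₀, s) := fun hG' ↦ contDiff_slice_of_contDiffOn_prod hG' hy₀
  have hΛ : FlatTo k (fun s ↦ ∑ i, ∑ j,
      (Matrix.of fun i j ↦ (h s).val (Φ.symm (Φ x₀))
        (e.localFrame b i (Φ.symm (Φ x₀))) (e.localFrame b j (Φ.symm (Φ x₀))))⁻¹ i j *
      (fderiv ℝ (fderiv ℝ (V s ∘ Φ.symm)) (Φ x₀) (b i) (b j) -
        ∑ l, (∑ k, 2⁻¹ *
          (fderiv ℝ (fun z ↦ (h s).val (Φ.symm z)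
              (e.localFrame b j (Φ.symm z)) (e.localFrame b k (Φ.symm z))) (Φ x₀) (b i) +
            fderiv ℝ (fun z ↦ (h s).val (Φ.symm z)
              (e.localFrame b i (Φ.symm z)) (e.localFrame b k (Φ.symm z))) (Φ x₀) (b j) -
            fderiv ℝ (fun z ↦ (h s).val (Φ.symm z)
              (e.localFrame b i (Φ.symm z)) (e.localFrame b j (Φ.symm z))) (Φ x₀) (b k)) *
          (Matrix.of fun i j ↦ (h s).val (Φ.symm (Φ x₀))
            (e.localFrame b i (Φ.symm (Φ x₀))) (e.localFrame b j (Φ.symm (Φ x₀))))⁻¹ k l) *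
          fderiv ℝ (V s ∘ Φ.symm) (Φ x₀) (b l))) := by
    refine FlatTo.sum _ fun i _ ↦ FlatTo.sum _ fun j _ ↦ ?_
    refine FlatTo.mul_left (hsl (hGinv i j)) ?_
    refine FlatTo.sub (hD2 (b i) (b j) (Φ x₀) hy₀) ?_
    refine FlatTo.sum _ fun l _ ↦ ?_
    refine FlatTo.mul_left ?_ (hD1 (b l) (Φ x₀) hy₀)
    refine ContDiff.sum fun k' _ ↦ ?_
    exact (contDiff_const.mul (((hsl (hdG j k' (b i))).add (hsl (hdG i k' (b j)))).sub
      (hsl (hdG i j (b k'))))).mul (hsl (hGinv k' l))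
  have hΔ : FlatTo k (fun s ↦ (h s).laplaceBeltrami (V s) x₀) :=
    hΛ.congr (funext fun s ↦ (hagree s).symm)
  exact hΔ.sub (FlatTo.mul_left (contDiff_time_slice hQ x₀) ⟨contDiff_time_slice hV x₀, hflat x₀⟩)

/-! ### The formal power series solution: Taylor polynomials and jets -/

/-- **The Taylor polynomials in time of the formal solution** of `∂ₛ w = L(s) w`, `w(0) = w₀`:
`P₀ = w₀` and `P_{k+1}(s) = P_k(s) + s^{k+1}/(k+1)! · (d/ds)^k [L(s) P_k(s)]|_{s=0}` — the
`(k+1)`-st Taylor coefficient is forced by the equation differentiated `k` times at `s = 0`.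
[folklore] -/
def heatTaylor (L : ℝ → (M → ℝ) → M → ℝ) (w₀ : M → ℝ) : ℕ → ℝ → M → ℝ
  | 0 => fun _ x ↦ w₀ x
  | k + 1 => fun s x ↦ heatTaylor L w₀ k s x +
      s ^ (k + 1) / ((k + 1).factorial : ℝ) *
        iteratedDeriv k (fun r ↦ L r (heatTaylor L w₀ k r) x) 0

/-- **The jets of the formal solution**: `a_k = (d/ds)^k P_k (0)`. [folklore] -/
def heatJet (L : ℝ → (M → ℝ) → M → ℝ) (w₀ : M → ℝ) (k : ℕ) (x : M) : ℝ :=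
  iteratedDeriv k (fun s ↦ heatTaylor L w₀ k s x) 0

omit [TopologicalSpace M] [ChartedSpace H M] [IsManifold I ∞ M] [I.Boundaryless]
  [FiniteDimensional ℝ E] [CompleteSpace E] in
/-- The recursion step of `heatTaylor`. [folklore] -/
theorem heatTaylor_succ (L : ℝ → (M → ℝ) → M → ℝ) (w₀ : M → ℝ) (k : ℕ) (s : ℝ) (x : M) :
    heatTaylor L w₀ (k + 1) s x = heatTaylor L w₀ k s x +
      s ^ (k + 1) / ((k + 1).factorial : ℝ) *
        iteratedDeriv k (fun r ↦ L r (heatTaylor L w₀ k r) x) 0 := rfl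

omit [TopologicalSpace M] [ChartedSpace H M] [IsManifold I ∞ M] [I.Boundaryless]
  [FiniteDimensional ℝ E] [CompleteSpace E] in
/-- `P₀ = w₀`. [folklore] -/
@[simp] theorem heatTaylor_zero (L : ℝ → (M → ℝ) → M → ℝ) (w₀ : M → ℝ) (s : ℝ) (x : M) :
    heatTaylor L w₀ 0 s x = w₀ x := rfl

omit [NormedAddCommGroup E] [NormedSpace ℝ E] [TopologicalSpace H] [TopologicalSpace M]
  [ChartedSpace H M] [IsManifold I ∞ M] [I.Boundaryless] [FiniteDimensional ℝ E]
  [CompleteSpace E] in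
/-- The jets of a monomial `s^{k+1}/(k+1)! · C` at `0`. [folklore] -/
theorem iteratedDeriv_monomial_zero (k n : ℕ) (C : ℝ) :
    iteratedDeriv n (fun s : ℝ ↦ s ^ (k + 1) / ((k + 1).factorial : ℝ) * C) 0 =
      if n = k + 1 then C else 0 := by
  have hfun : (fun s : ℝ ↦ s ^ (k + 1) / ((k + 1).factorial : ℝ) * C) =
      fun s ↦ (C / ((k + 1).factorial : ℝ)) * s ^ (k + 1) := by
    funext s; ring
  rw [hfun, show (fun s : ℝ ↦ C / ((k + 1).factorial : ℝ) * s ^ (k + 1)) =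
      (C / ((k + 1).factorial : ℝ)) • (fun s : ℝ ↦ s ^ (k + 1)) from rfl,
    iteratedDeriv_const_smul ((contDiff_id.pow (k + 1)).contDiffAt) _]
  have := iteratedDeriv_fun_pow_zero (𝕜 := ℝ) (n := n) (m := k + 1)
  simp only [smul_eq_mul, this]
  have hne : ((k + 1).factorial : ℝ) ≠ 0 := by exact_mod_cast (Nat.factorial_pos _).ne'
  split_ifs with hnk
  · field_simp
  · simp

section Taylor

variable (hh : IsContMDiffFamilyOn ∞ h univ)
  (hQ : ContMDiff (I.prod 𝓘(ℝ, ℝ)) 𝓘(ℝ, ℝ) ∞ (fun p : M × ℝ ↦ Q p.2 p.1))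
  {w₀ : M → ℝ} (hw₀ : ContMDiff I 𝓘(ℝ, ℝ) ∞ w₀)

/-- The operator `L(s) f = Δ_{h(s)} f − Q(s) f` of the linear heat equation. [folklore] -/
def heatOp (h : ℝ → PseudoRiemannianMetric I ∞ E (TangentSpace I : M → Type _))
    (Q : ℝ → M → ℝ) (s : ℝ) (f : M → ℝ) (x : M) : ℝ :=
  (h s).laplaceBeltrami f x - Q s x * f x

omit [I.Boundaryless] in
/-- Unfolding `heatOp`. [folklore] -/
@[simp] theorem heatOp_apply (s : ℝ) (f : M → ℝ) (x : M) :
    heatOp h Q s f x = (h s).laplaceBeltrami f x - Q s x * f x := rfl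

include hh hQ in
/-- `contMDiff_heatOp` in terms of `heatOp`. [cite: Topping2006, §1.2.3] -/
theorem contMDiff_heatOp' {V : ℝ → M → ℝ}
    (hV : ContMDiff (I.prod 𝓘(ℝ, ℝ)) 𝓘(ℝ, ℝ) ∞ (fun p : M × ℝ ↦ V p.2 p.1)) :
    ContMDiff (I.prod 𝓘(ℝ, ℝ)) 𝓘(ℝ, ℝ) ∞ (fun p : M × ℝ ↦ heatOp h Q p.2 (V p.2) p.1) :=
  contMDiff_heatOp hh hQ hV

include hh hQ hw₀ in
/-- **The Taylor polynomials are smooth on space-time.** [folklore] -/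
theorem contMDiff_heatTaylor (k : ℕ) :
    ContMDiff (I.prod 𝓘(ℝ, ℝ)) 𝓘(ℝ, ℝ) ∞
      (fun p : M × ℝ ↦ heatTaylor (heatOp h Q) w₀ k p.2 p.1) := by
  induction k with
  | zero => exact hw₀.comp contMDiff_fst
  | succ k IH =>
    have h1 : ContMDiff (I.prod 𝓘(ℝ, ℝ)) 𝓘(ℝ, ℝ) ∞ (fun p : M × ℝ ↦
        heatOp h Q p.2 (heatTaylor (heatOp h Q) w₀ k p.2) p.1) := contMDiff_heatOp' hh hQ IH
    have h2 : ContMDiff (I.prod 𝓘(ℝ, ℝ)) 𝓘(ℝ, ℝ) ∞ (fun p : M × ℝ ↦ iteratedDeriv k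
        (fun r ↦ heatOp h Q r (heatTaylor (heatOp h Q) w₀ k r) p.1) p.2) :=
      contMDiff_iteratedDeriv_time
        (V := fun r x ↦ heatOp h Q r (heatTaylor (heatOp h Q) w₀ k r) x) h1 k
    have hι : ContMDiff I (I.prod 𝓘(ℝ, ℝ)) ∞ fun x : M ↦ (x, (0 : ℝ)) :=
      contMDiff_id.prodMk contMDiff_const
    have h3 : ContMDiff I 𝓘(ℝ, ℝ) ∞ fun x ↦ iteratedDeriv k
        (fun r ↦ heatOp h Q r (heatTaylor (heatOp h Q) w₀ k r) x) 0 :=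
      ContMDiff.comp (I' := I.prod 𝓘(ℝ, ℝ))
        (g := fun p : M × ℝ ↦ iteratedDeriv k
          (fun r ↦ heatOp h Q r (heatTaylor (heatOp h Q) w₀ k r) p.1) p.2)
        (f := fun x : M ↦ (x, (0 : ℝ))) h2 hι
    have h4 : ContMDiff (I.prod 𝓘(ℝ, ℝ)) 𝓘(ℝ, ℝ) ∞
        fun p : M × ℝ ↦ p.2 ^ (k + 1) / ((k + 1).factorial : ℝ) :=
      ((contDiff_id.pow (k + 1)).div_const _).comp_contMDiff contMDiff_snd
    have h5 : (fun p : M × ℝ ↦ heatTaylor (heatOp h Q) w₀ (k + 1) p.2 p.1) =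
        fun p : M × ℝ ↦ heatTaylor (heatOp h Q) w₀ k p.2 p.1 + p.2 ^ (k + 1) /
          ((k + 1).factorial : ℝ) * iteratedDeriv k
            (fun r ↦ heatOp h Q r (heatTaylor (heatOp h Q) w₀ k r) p.1) 0 := by
      funext p; rw [heatTaylor_succ]
    rw [h5]
    exact IH.add (h4.mul (h3.comp contMDiff_fst))

include hh hQ hw₀ in
/-- The jets of `P_{k+1}` at `0`: those of `P_k`, plus the new coefficient in degree `k + 1`.
[folklore] -/
theorem iteratedDeriv_heatTaylor_succ (k n : ℕ) (x : M) :
    iteratedDeriv n (fun s ↦ heatTaylor (heatOp h Q) w₀ (k + 1) s x) 0 =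
      iteratedDeriv n (fun s ↦ heatTaylor (heatOp h Q) w₀ k s x) 0 +
        (if n = k + 1 then iteratedDeriv k
          (fun r ↦ heatOp h Q r (heatTaylor (heatOp h Q) w₀ k r) x) 0 else 0) := by
  have hs : ContDiff ℝ ∞ fun s ↦ heatTaylor (heatOp h Q) w₀ k s x :=
    contDiff_time_slice (contMDiff_heatTaylor hh hQ hw₀ k) x
  set C := iteratedDeriv k (fun r ↦ heatOp h Q r (heatTaylor (heatOp h Q) w₀ k r) x) 0 with hC
  have hm : ContDiff ℝ ∞ fun s : ℝ ↦ s ^ (k + 1) / ((k + 1).factorial : ℝ) * C :=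
    ((contDiff_id.pow (k + 1)).div_const _).mul contDiff_const
  have hfun : (fun s ↦ heatTaylor (heatOp h Q) w₀ (k + 1) s x) =
      (fun s ↦ heatTaylor (heatOp h Q) w₀ k s x) +
        fun s : ℝ ↦ s ^ (k + 1) / ((k + 1).factorial : ℝ) * C := by
    funext s; rfl
  rw [hfun, iteratedDeriv_add (hs.contDiffAt.of_le (by exact_mod_cast le_top))
    (hm.contDiffAt.of_le (by exact_mod_cast le_top)), iteratedDeriv_monomial_zero]

include hh hQ hw₀ in
/-- **The jets of the Taylor polynomials stabilise**: `(d/ds)^n P_k (0) = a_n` for `n ≤ k`.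
[folklore] -/
theorem iteratedDeriv_heatTaylor_of_le {k n : ℕ} (hn : n ≤ k) (x : M) :
    iteratedDeriv n (fun s ↦ heatTaylor (heatOp h Q) w₀ k s x) 0 = heatJet (heatOp h Q) w₀ n x := by
  induction k with
  | zero =>
    obtain rfl : n = 0 := Nat.le_zero.mp hn
    rfl
  | succ k IH =>
    rcases Nat.lt_or_ge n (k + 1) with h1 | h1
    · rw [iteratedDeriv_heatTaylor_succ hh hQ hw₀, if_neg h1.ne, add_zero]
      exact IH (Nat.lt_succ_iff.mp h1)
    · obtain rfl : n = k + 1 := le_antisymm hn h1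
      rfl

include hh hQ hw₀ in
/-- The Taylor polynomial `P_k` has no jets beyond order `k`. [folklore] -/
theorem iteratedDeriv_heatTaylor_of_lt {k n : ℕ} (hn : k < n) (x : M) :
    iteratedDeriv n (fun s ↦ heatTaylor (heatOp h Q) w₀ k s x) 0 = 0 := by
  induction k with
  | zero =>
    simp only [heatTaylor_zero]
    rw [iteratedDeriv_const]
    simp [Nat.pos_iff_ne_zero.mp hn]
  | succ k IH =>
    rw [iteratedDeriv_heatTaylor_succ hh hQ hw₀, IH (by omega), if_neg (by omega), add_zero]

include hh hQ hw₀ in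
/-- **The recursion for the jets**: `a_{k+1} = (d/ds)^k [L(s) P_k(s)]|_{s=0}`. [folklore] -/
theorem heatJet_succ (k : ℕ) (x : M) :
    heatJet (heatOp h Q) w₀ (k + 1) x =
      iteratedDeriv k (fun r ↦ heatOp h Q r (heatTaylor (heatOp h Q) w₀ k r) x) 0 := by
  unfold heatJet
  rw [iteratedDeriv_heatTaylor_succ hh hQ hw₀, iteratedDeriv_heatTaylor_of_lt hh hQ hw₀
    (Nat.lt_succ_self k), if_pos rfl, zero_add]

omit [I.Boundaryless] in
/-- `a₀ = w₀`. [folklore] -/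
theorem heatJet_zero (x : M) : heatJet (heatOp h Q) w₀ 0 x = w₀ x := by
  simp [heatJet]

include hh hQ hw₀ in
/-- The jets are smooth. [folklore] -/
theorem contMDiff_heatJet (k : ℕ) : ContMDiff I 𝓘(ℝ, ℝ) ∞ (heatJet (heatOp h Q) w₀ k) :=
  (contMDiff_iteratedDeriv_time (contMDiff_heatTaylor hh hQ hw₀ k) k).comp
    (contMDiff_id.prodMk contMDiff_const)

include hh hQ hw₀ in
/-- **A smooth space-time function with the jets of the formal solution solves the equation to
infinite order at `s = 0`**: if `(d/ds)^k W(·, 0) = a_k` for all `k`, then every time slice of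
`∂ₛW − (Δ_{h(s)} W − Q W)` is flat at `s = 0`. Indeed `W − P_k` is flat to order `k`, so is its
image under the heat operator (`flatTo_heatOp`), and
`(d/ds)^k [L P_k]|₀ = a_{k+1} = (d/ds)^{k+1} W|₀`. [folklore] -/
theorem iteratedDeriv_residual_eq_zero {W : ℝ → M → ℝ}
    (hW : ContMDiff (I.prod 𝓘(ℝ, ℝ)) 𝓘(ℝ, ℝ) ∞ (fun p : M × ℝ ↦ W p.2 p.1))
    (hjet : ∀ (k : ℕ) (x : M), iteratedDeriv k (fun s ↦ W s x) 0 = heatJet (heatOp h Q) w₀ k x)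
    (x : M) (k : ℕ) :
    iteratedDeriv k (fun s ↦ deriv (fun r ↦ W r x) s - heatOp h Q s (W s) x) 0 = 0 := by
  set P := heatTaylor (heatOp h Q) w₀ k with hP
  have hPs := contMDiff_heatTaylor hh hQ hw₀ k
  set R : ℝ → M → ℝ := fun s y ↦ W s y - P s y with hR
  have hRs : ContMDiff (I.prod 𝓘(ℝ, ℝ)) 𝓘(ℝ, ℝ) ∞ (fun p : M × ℝ ↦ R p.2 p.1) := hW.sub hPs
  have hRflat : ∀ y, ∀ i ≤ k, iteratedDeriv i (fun s ↦ R s y) 0 = 0 := by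
    intro y i hi
    have h1 : (fun s ↦ R s y) = (fun s ↦ W s y) - fun s ↦ P s y := by funext s; rfl
    rw [h1, iteratedDeriv_sub ((contDiff_time_slice hW y).contDiffAt.of_le
        (by exact_mod_cast le_top))
      ((contDiff_time_slice hPs y).contDiffAt.of_le (by exact_mod_cast le_top)),
      hjet i y, iteratedDeriv_heatTaylor_of_le hh hQ hw₀ hi, sub_self]
  have hLR : FlatTo k (fun s ↦ heatOp h Q s (R s) x) := flatTo_heatOp hh hQ hRs hRflat x
  -- linearity of the operator
  have hsplit : ∀ s, heatOp h Q s (W s) x = heatOp h Q s (P s) x + heatOp h Q s (R s) x := by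
    intro s
    have h2 : (2 : ℕ∞ω) ≤ ∞ := by norm_cast
    have hWs : ContMDiffAt I 𝓘(ℝ, ℝ) 2 (W s) x := ((contMDiff_space_slice hW s).of_le h2) x
    have hPs' : ContMDiffAt I 𝓘(ℝ, ℝ) 2 (P s) x := ((contMDiff_space_slice hPs s).of_le h2) x
    have hRW : R s = W s - P s := by funext y; rfl
    simp only [heatOp]
    rw [hRW, (h s).laplaceBeltrami_sub hWs hPs']
    simp only [Pi.sub_apply]
    ring
  -- smoothness of the pieces in time
  have hLW : ContDiff ℝ ∞ fun s ↦ heatOp h Q s (W s) x :=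
    contDiff_time_slice (V := fun s y ↦ heatOp h Q s (W s) y) (contMDiff_heatOp' hh hQ hW) x
  have hLP : ContDiff ℝ ∞ fun s ↦ heatOp h Q s (P s) x :=
    contDiff_time_slice (V := fun s y ↦ heatOp h Q s (P s) y) (contMDiff_heatOp' hh hQ hPs) x
  have hdW : ContDiff ℝ ∞ (deriv fun r ↦ W r x) :=
    (contDiff_infty_iff_deriv.mp (contDiff_time_slice hW x)).2
  -- compute
  have e1 : (fun s ↦ deriv (fun r ↦ W r x) s - heatOp h Q s (W s) x) =
      (deriv fun r ↦ W r x) - fun s ↦ heatOp h Q s (W s) x := by funext s; rfl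
  have e2 : (fun s ↦ heatOp h Q s (W s) x) =
      (fun s ↦ heatOp h Q s (P s) x) + fun s ↦ heatOp h Q s (R s) x := by
    funext s; exact hsplit s
  rw [e1, iteratedDeriv_sub (hdW.contDiffAt.of_le (by exact_mod_cast le_top))
      (hLW.contDiffAt.of_le (by exact_mod_cast le_top)),
    ← iteratedDeriv_succ', hjet (k + 1) x, heatJet_succ hh hQ hw₀, e2,
    iteratedDeriv_add (hLP.contDiffAt.of_le (by exact_mod_cast le_top))
      (hLR.1.contDiffAt.of_le (by exact_mod_cast le_top)), hLR.2 k le_rfl, add_zero, sub_self]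

end Taylor

end Family

/-! ### Borel's lemma on a compact manifold -/

section ManifoldBorel

variable {E : Type*} [NormedAddCommGroup E] [NormedSpace ℝ E] [FiniteDimensional ℝ E]
  {H : Type*} [TopologicalSpace H] {I : ModelWithCorners ℝ E H} [I.Boundaryless]
  {M : Type*} [TopologicalSpace M] [ChartedSpace H M] [IsManifold I ∞ M]
  [T2Space M] [CompactSpace M]

omit [FiniteDimensional ℝ E] [T2Space M] in
/-- **Chart transfer of Borel data**: for a smooth `ρ` supported in the chart domain of `x₀` and
smooth `a_k`, the functions `bₖ = 1_{Φ.target} · (ρ a_k) ∘ Φ⁻¹` (`Φ = extChartAt I x₀`) are smooth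
on the model space and vanish off the compact set `Φ(tsupport ρ)`. [folklore] -/
theorem exists_chart_borelData (x₀ : M) {ρ : M → ℝ} (hρ : ContMDiff I 𝓘(ℝ, ℝ) ∞ ρ)
    (hρs : tsupport ρ ⊆ (chartAt H x₀).source) {a : ℕ → M → ℝ}
    (ha : ∀ k, ContMDiff I 𝓘(ℝ, ℝ) ∞ (a k)) :
    ∃ b : ℕ → E → ℝ, (∀ k, ContDiff ℝ ∞ (b k)) ∧ (∀ k, HasCompactSupport (b k)) ∧
      (∀ k, ∀ x ∈ (chartAt H x₀).source, b k (extChartAt I x₀ x) = ρ x * a k x) ∧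
      (∀ k y, y ∉ extChartAt I x₀ '' tsupport ρ → b k y = 0) := by
  set Φ := extChartAt I x₀ with hΦ
  have hsrc : (chartAt H x₀).source = Φ.source := by rw [hΦ, extChartAt_source]
  have hVt : IsOpen Φ.target := isOpen_extChartAt_target x₀
  -- the compact set
  set K : Set E := Φ '' tsupport ρ with hK
  have hKc : IsCompact K := by
    refine ((isClosed_tsupport ρ).isCompact).image_of_continuousOn ?_
    exact (continuousOn_extChartAt x₀).mono (by rwa [← hsrc])
  have hKt : K ⊆ Φ.target := by
    rintro _ ⟨x, hx, rfl⟩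
    exact Φ.map_source (by rw [← hsrc]; exact hρs hx)
  -- the functions
  set b : ℕ → E → ℝ := fun k ↦ Φ.target.indicator fun y ↦ ρ (Φ.symm y) * a k (Φ.symm y) with hb
  have hb_in : ∀ k, ∀ y ∈ Φ.target, b k y = ρ (Φ.symm y) * a k (Φ.symm y) :=
    fun k y hy ↦ by simp [hb, indicator_of_mem hy]
  have hb_out : ∀ k y, y ∉ K → b k y = 0 := by
    intro k y hy
    by_cases hyt : y ∈ Φ.target
    · rw [hb_in k y hyt]
      have : Φ.symm y ∉ tsupport ρ := by
        intro h'
        exact hy ⟨Φ.symm y, h', Φ.right_inv hyt⟩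
      rw [image_eq_zero_of_notMem_tsupport this, zero_mul]
    · simp [hb, indicator_of_notMem hyt]
  have hb_chart : ∀ k, ∀ x ∈ (chartAt H x₀).source, b k (Φ x) = ρ x * a k x := by
    intro k x hx
    rw [hsrc] at hx
    rw [hb_in k (Φ x) (Φ.map_source hx), Φ.left_inv hx]
  -- smoothness
  have hb_on : ∀ k, ContDiffOn ℝ ∞ (b k) Φ.target := by
    intro k
    have h1 : ContMDiffOn 𝓘(ℝ, E) 𝓘(ℝ, ℝ) ∞ (fun y ↦ ρ (Φ.symm y) * a k (Φ.symm y)) Φ.target :=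
      ((hρ.mul (ha k)).comp_contMDiffOn (contMDiffOn_extChartAt_symm x₀))
    exact (contMDiffOn_iff_contDiffOn.1 h1).congr fun y hy ↦ hb_in k y hy
  have hbs : ∀ k, ContDiff ℝ ∞ (b k) := by
    intro k
    rw [contDiff_iff_contDiffAt]
    intro y
    by_cases hy : y ∈ Φ.target
    · exact (hb_on k).contDiffAt (hVt.mem_nhds hy)
    · have hyK : y ∉ K := fun h ↦ hy (hKt h)
      have hev : b k =ᶠ[𝓝 y] fun _ ↦ 0 := by
        filter_upwards [hKc.isClosed.isOpen_compl.mem_nhds hyK] with z hz using hb_out k z hz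
      exact (contDiffAt_const (c := (0 : ℝ))).congr_of_eventuallyEq hev
  have hbK : ∀ k, HasCompactSupport (b k) :=
    fun k ↦ HasCompactSupport.intro hKc fun y hy ↦ hb_out k y hy
  exact ⟨b, hbs, hbK, hb_chart, hb_out⟩

/-- **Borel's lemma on a compact manifold, in the time variable**: for smooth `a_k : M → ℝ`
there is `W : ℝ → M → ℝ`, smooth on `M × ℝ`, with `(d/ds)^k W(·, x)|_{s=0} = a_k(x)` for all
`k, x`. Proof: a finite smooth partition of unity subordinate to chart domains reduces to Borel's
lemma with parameters on the model space (`exists_borel_extension`, cut-off series form).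
[folklore] -/
theorem exists_contMDiff_forall_iteratedDeriv_eq_manifold {a : ℕ → M → ℝ}
    (ha : ∀ k, ContMDiff I 𝓘(ℝ, ℝ) ∞ (a k)) :
    ∃ W : ℝ → M → ℝ, ContMDiff (I.prod 𝓘(ℝ, ℝ)) 𝓘(ℝ, ℝ) ∞ (fun p : M × ℝ ↦ W p.2 p.1) ∧
      ∀ (k : ℕ) (x : M), iteratedDeriv k (fun s ↦ W s x) 0 = a k x := by
  classical
  -- a finite chart cover and a subordinate smooth partition of unity
  obtain ⟨t, ht⟩ := isCompact_univ.elim_finite_subcover (fun x : M ↦ (chartAt H x).source)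
    (fun x ↦ (chartAt H x).open_source) (fun x _ ↦ mem_iUnion.2 ⟨x, mem_chart_source H x⟩)
  set U : ↥t → Set M := fun i ↦ (chartAt H (i : M)).source with hU
  have hUo : ∀ i, IsOpen (U i) := fun i ↦ (chartAt H (i : M)).open_source
  have hUc : univ ⊆ ⋃ i, U i := by
    intro x hx
    obtain ⟨i, hi, hx'⟩ := mem_iUnion₂.1 (ht hx)
    exact mem_iUnion.2 ⟨⟨i, hi⟩, hx'⟩
  obtain ⟨ρ, hρU⟩ := SmoothPartitionOfUnity.exists_isSubordinate I isClosed_univ U hUo hUc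
  -- chart-wise Borel data and Borel functions
  have hdata := fun i : ↥t ↦ exists_chart_borelData (I := I) (i : M) (ρ i).contMDiff (hρU i) ha
  choose b hbs hbK hbchart hbout using hdata
  have hW := fun i : ↥t ↦ exists_borel_extension (b i) (hbs i) (hbK i) (fun _ ↦ 1) fun _ ↦ one_pos
  choose ε hε hWcs hWcjet using hW
  set Wc : ↥t → E × ℝ → ℝ := fun i z ↦ ∑' k, cutoffMonomial k (ε i k) z.2 * b i k z.1 with hWc
  have hWczero : ∀ i y, (∀ k, b i k y = 0) → ∀ s, Wc i (y, s) = 0 := by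
    intro i y hy s; simp [hWc, hy]
  -- transplant to `M`
  set Wt : ↥t → ℝ → M → ℝ := fun i s x ↦
    if x ∈ (chartAt H (i : M)).source then Wc i (extChartAt I (i : M) x, s) else 0 with hWt
  have hWt_zero : ∀ i, ∀ x ∉ tsupport (ρ i), ∃ N ∈ 𝓝 x, ∀ x' ∈ N, ∀ s, Wt i s x' = 0 := by
    intro i x hx
    refine ⟨(tsupport (ρ i))ᶜ, (isClosed_tsupport _).isOpen_compl.mem_nhds hx, fun x' hx' s ↦ ?_⟩
    simp only [hWt]
    split_ifs with hsrc
    · apply hWczero i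
      intro k
      apply hbout i k
      rintro ⟨x'', hx'', heq⟩
      have h1 : x'' ∈ (extChartAt I (i : M)).source := by
        rw [extChartAt_source]; exact hρU i hx''
      have h2 : x' ∈ (extChartAt I (i : M)).source := by rwa [extChartAt_source]
      have : x'' = x' := (extChartAt I (i : M)).injOn h1 h2 heq
      exact hx' (this ▸ hx'')
    · rfl
  have hWt_smooth : ∀ i, ContMDiff (I.prod 𝓘(ℝ, ℝ)) 𝓘(ℝ, ℝ) ∞ (fun p : M × ℝ ↦ Wt i p.2 p.1) := by
    intro i
    rintro ⟨x, s⟩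
    by_cases hx : x ∈ (chartAt H (i : M)).source
    · -- composition with the product chart on the chart domain
      have hsrc : x ∈ (extChartAt I (i : M)).source := by rwa [extChartAt_source]
      have hO : IsOpen ((extChartAt I (i : M)).source ×ˢ (univ : Set ℝ)) :=
        (isOpen_extChartAt_source (i : M)).prod isOpen_univ
      have hmem : (x, s) ∈ (extChartAt I (i : M)).source ×ˢ (univ : Set ℝ) := ⟨hsrc, mem_univ _⟩
      have hcomp : ContMDiffWithinAt (I.prod 𝓘(ℝ, ℝ)) 𝓘(ℝ, ℝ) ∞
          (Wc i ∘ fun z : M × ℝ ↦ (extChartAt I (i : M) z.1, z.2))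
          ((extChartAt I (i : M)).source ×ˢ (univ : Set ℝ)) (x, s) :=
        (hWcs i).comp_contMDiffWithinAt (contMDiffOn_extChartAt_prod_id (i : M) univ _ hmem)
      have heq : ∀ z ∈ (extChartAt I (i : M)).source ×ˢ (univ : Set ℝ),
          Wt i z.2 z.1 = (Wc i ∘ fun z : M × ℝ ↦ (extChartAt I (i : M) z.1, z.2)) z := by
        rintro ⟨x', s'⟩ ⟨hx', -⟩
        have hx'' : x' ∈ (chartAt H (i : M)).source := by rwa [extChartAt_source] at hx'
        simp [hWt, hx'']
      exact ((hcomp.congr (fun z hz ↦ heq z hz) (heq _ hmem)).contMDiffAt (hO.mem_nhds hmem))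
    · obtain ⟨N, hN, hN0⟩ := hWt_zero i x (fun h ↦ hx (hρU i h))
      have hev : (fun p : M × ℝ ↦ Wt i p.2 p.1) =ᶠ[𝓝 (x, s)] fun _ ↦ 0 := by
        have : N ×ˢ (univ : Set ℝ) ∈ 𝓝 (x, s) := prod_mem_nhds hN univ_mem
        filter_upwards [this] with p hp using hN0 p.1 hp.1 p.2
      exact contMDiffAt_const.congr_of_eventuallyEq hev
  have hWt_jet : ∀ i k x, iteratedDeriv k (fun s ↦ Wt i s x) 0 = ρ i x * a k x := by
    intro i k x
    by_cases hx : x ∈ (chartAt H (i : M)).source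
    · have h1 : (fun s ↦ Wt i s x) =
          fun s ↦ ∑' k, cutoffMonomial k (ε i k) s * b i k (extChartAt I (i : M) x) := by
        funext s; simp [hWt, hx, hWc]
      rw [h1, hWcjet i, hbchart i k x hx]
    · have h1 : (fun s ↦ Wt i s x) = fun _ ↦ (0 : ℝ) := by
        funext s; simp [hWt, hx]
      rw [h1, iteratedDeriv_const, image_eq_zero_of_notMem_tsupport (fun h ↦ hx (hρU i h))]
      simp
  -- the sum over the cover
  refine ⟨fun s x ↦ ∑ i, Wt i s x, contMDiff_finsetSum fun i _ ↦ hWt_smooth i, fun k x ↦ ?_⟩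
  have h1 : (fun s ↦ ∑ i, Wt i s x) = ∑ i, (fun s ↦ Wt i s x) := by
    funext s; simp only [Finset.sum_apply]
  rw [h1, iteratedDeriv_sum (fun i _ ↦ ((contDiff_time_slice (hWt_smooth i) x).contDiffAt.of_le
    (by exact_mod_cast le_top)))]
  simp_rw [hWt_jet]
  rw [← Finset.sum_mul]
  have hone : ∑ i, ρ i x = 1 := by
    rw [← finsum_eq_sum_of_fintype]
    exact ρ.sum_eq_one (mem_univ x)
  rw [hone, one_mul]

end ManifoldBorel

/-! ### Gluing a flat space-time function with zero across `s = 0` -/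

section Glue

/- The model space `E` is taken in `Type` (universe `0`, where `EuclideanSpace ℝ (Fin m)`
lives): the gluing theorem `IsTFlatOn.contDiffOn_cutoff` of `FlatGluing.lean` takes the source
`E` and the target (here `ℝ`) in a common universe. -/
variable {E : Type} [NormedAddCommGroup E] [NormedSpace ℝ E]
  {H : Type*} [TopologicalSpace H] {I : ModelWithCorners ℝ E H} [I.Boundaryless]
  {M : Type*} [TopologicalSpace M] [ChartedSpace H M] [IsManifold I ∞ M]

/-- **A smooth space-time function all of whose time slices are flat at `s = 0` stays smooth when
replaced by `0` for `s ≤ 0`** (read in product charts: `IsTFlatOn.contDiffOn_cutoff` of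
`FlatGluing.lean`, via `isTFlatOn_iff_iteratedDeriv`). [folklore] -/
theorem contMDiff_timeCutoff_manifold {F : ℝ → M → ℝ}
    (hF : ContMDiff (I.prod 𝓘(ℝ, ℝ)) 𝓘(ℝ, ℝ) ∞ (fun p : M × ℝ ↦ F p.2 p.1))
    (hflat : ∀ (x : M) (i : ℕ), iteratedDeriv i (fun s ↦ F s x) 0 = 0) :
    ContMDiff (I.prod 𝓘(ℝ, ℝ)) 𝓘(ℝ, ℝ) ∞
      (fun p : M × ℝ ↦ if 0 < p.2 then F p.2 p.1 else 0) := by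
  rintro ⟨x₀, s₀⟩
  set Φ := extChartAt I x₀ with hΦ
  have hVt : IsOpen Φ.target := isOpen_extChartAt_target x₀
  have hsrc : x₀ ∈ Φ.source := mem_extChartAt_source x₀
  set Fc : E × ℝ → ℝ := fun q ↦ F q.2 (Φ.symm q.1) with hFc
  have hOt : IsOpen (Φ.target ×ˢ (univ : Set ℝ)) := hVt.prod isOpen_univ
  have hFcs : ContDiffOn ℝ ∞ Fc (Φ.target ×ˢ univ) :=
    contDiffOn_time_chart (k := (⊤ : ℕ∞)) (by rw [univ_prod_univ]; exact hF.contMDiffOn) x₀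
  have hFcflat : IsTFlatOn (Φ.target ×ˢ (univ : Set ℝ)) Fc :=
    (isTFlatOn_iff_iteratedDeriv hOt hFcs).2 fun k y _ ↦ hflat (Φ.symm y) k
  have hglue : ContDiffOn ℝ ∞ (fun w : E × ℝ ↦ if 0 < w.2 then Fc w else 0) (Φ.target ×ˢ univ) :=
    hFcflat.contDiffOn_cutoff hOt hFcs
  have hO : IsOpen (Φ.source ×ˢ (univ : Set ℝ)) := (isOpen_extChartAt_source x₀).prod isOpen_univ
  have hmem : (x₀, s₀) ∈ Φ.source ×ˢ (univ : Set ℝ) := ⟨hsrc, mem_univ _⟩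
  have hmaps : MapsTo (fun z : M × ℝ ↦ (Φ z.1, z.2)) (Φ.source ×ˢ (univ : Set ℝ))
      (Φ.target ×ˢ univ) := fun z hz ↦ ⟨Φ.map_source hz.1, mem_univ _⟩
  have hcomp : ContMDiffWithinAt (I.prod 𝓘(ℝ, ℝ)) 𝓘(ℝ, ℝ) ∞
      ((fun w : E × ℝ ↦ if 0 < w.2 then Fc w else 0) ∘ fun z : M × ℝ ↦ (Φ z.1, z.2))
      (Φ.source ×ˢ (univ : Set ℝ)) (x₀, s₀) :=
    ContDiffWithinAt.comp_contMDiffWithinAt (f := fun z : M × ℝ ↦ (Φ z.1, z.2)) (x := (x₀, s₀))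
      (hglue _ (hmaps hmem)) (contMDiffOn_extChartAt_prod_id x₀ univ _ hmem) hmaps
  have heq : ∀ z ∈ Φ.source ×ˢ (univ : Set ℝ),
      (fun p : M × ℝ ↦ if 0 < p.2 then F p.2 p.1 else 0) z =
        ((fun w : E × ℝ ↦ if 0 < w.2 then Fc w else 0) ∘ fun z : M × ℝ ↦ (Φ z.1, z.2)) z := by
    rintro ⟨x, s⟩ ⟨hx, -⟩
    simp only [comp_apply, hFc, Φ.left_inv hx]
  exact (hcomp.congr (fun z hz ↦ heq z hz) (heq _ hmem)).contMDiffAt (hO.mem_nhds hmem)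

end Glue

/-! ### The flat corrector -/

section Corrector

variable {E : Type} [NormedAddCommGroup E] [NormedSpace ℝ E] [FiniteDimensional ℝ E]
  [CompleteSpace E]
  {H : Type*} [TopologicalSpace H] {I : ModelWithCorners ℝ E H} [I.Boundaryless]
  {M : Type*} [TopologicalSpace M] [ChartedSpace H M] [IsManifold I ∞ M]
  [T2Space M] [CompactSpace M]
  {h : ℝ → PseudoRiemannianMetric I ∞ E (TangentSpace I : M → Type _)} {Q : ℝ → M → ℝ}

/-- **Reduction of the Cauchy problem to a problem with flat forcing supported in `s ≥ 0`.**
For a family of metrics `h` smooth on `M × ℝ`, a smooth potential `Q` and smooth initial data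
`w₀` on a closed manifold there are `W` and `G`, smooth on `M × ℝ`, with `W(0) = w₀`,
`G(s) = 0` for `s ≤ 0`, and `G = −(∂ₛW − Δ_{h(s)}W + QW)` for `s ≥ 0`. (Borel summation of the
formal power series solution, `exists_contMDiff_forall_iteratedDeriv_eq_manifold` with the jets
`heatJet`; the residual is flat, `iteratedDeriv_residual_eq_zero`, and is glued with zero,
`contMDiff_timeCutoff_manifold`.) The model space is taken in `Type` (see section `Glue`).
A solution `v` of `∂ₛv = Δ_{h(s)}v − Qv + G` vanishing for
`s ≤ 0` then gives the solution `W + v` of the Cauchy problem on `s ≥ 0`. [folklore] -/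
theorem exists_flat_corrector (hh : IsContMDiffFamilyOn ∞ h univ)
    (hQ : ContMDiff (I.prod 𝓘(ℝ, ℝ)) 𝓘(ℝ, ℝ) ∞ (fun p : M × ℝ ↦ Q p.2 p.1)) {w₀ : M → ℝ}
    (hw₀ : ContMDiff I 𝓘(ℝ, ℝ) ∞ w₀) :
    ∃ W G : ℝ → M → ℝ,
      ContMDiff (I.prod 𝓘(ℝ, ℝ)) 𝓘(ℝ, ℝ) ∞ (fun p : M × ℝ ↦ W p.2 p.1) ∧
      ContMDiff (I.prod 𝓘(ℝ, ℝ)) 𝓘(ℝ, ℝ) ∞ (fun p : M × ℝ ↦ G p.2 p.1) ∧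
      W 0 = w₀ ∧ (∀ s ≤ 0, ∀ x, G s x = 0) ∧
      ∀ s, 0 ≤ s → ∀ x, G s x =
        -(deriv (fun r ↦ W r x) s - ((h s).laplaceBeltrami (W s) x - Q s x * W s x)) := by
  obtain ⟨W, hWs, hWjet⟩ := exists_contMDiff_forall_iteratedDeriv_eq_manifold (I := I)
    (a := heatJet (heatOp h Q) w₀) (contMDiff_heatJet hh hQ hw₀)
  -- the residual and its flatness
  set F : ℝ → M → ℝ := fun s x ↦ -(deriv (fun r ↦ W r x) s - heatOp h Q s (W s) x) with hF
  have hFs : ContMDiff (I.prod 𝓘(ℝ, ℝ)) 𝓘(ℝ, ℝ) ∞ (fun p : M × ℝ ↦ F p.2 p.1) := by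
    have h1 : ContMDiff (I.prod 𝓘(ℝ, ℝ)) 𝓘(ℝ, ℝ) ∞
        (fun p : M × ℝ ↦ deriv (fun r ↦ W r p.1) p.2) := by
      have := contMDiff_iteratedDeriv_time hWs 1
      simpa only [iteratedDeriv_one] using this
    exact (h1.sub (contMDiff_heatOp' hh hQ hWs)).neg
  have hFflat : ∀ (x : M) (i : ℕ), iteratedDeriv i (fun s ↦ F s x) 0 = 0 := by
    intro x i
    have h1 : (fun s ↦ F s x) = fun s ↦ -(deriv (fun r ↦ W r x) s - heatOp h Q s (W s) x) := rfl
    rw [h1, iteratedDeriv_fun_neg, iteratedDeriv_residual_eq_zero hh hQ hw₀ hWs hWjet x i, neg_zero]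
  refine ⟨W, fun s x ↦ if 0 < s then F s x else 0, hWs, contMDiff_timeCutoff_manifold hFs hFflat,
    ?_, ?_, ?_⟩
  · funext x
    have := hWjet 0 x
    rw [iteratedDeriv_zero, heatJet_zero] at this
    exact this
  · intro s hs x
    simp [not_lt.2 hs]
  · intro s hs x
    rcases hs.lt_or_eq with hs' | rfl
    · simp [hs', hF]
    · have := hFflat x 0
      rw [iteratedDeriv_zero] at this
      simp only [hF, heatOp_apply] at this
      simp only [lt_irrefl, if_false]
      linarith

end Corrector

end Literature.Geometry.Riemannian
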